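import Summits.KontsevichZagierPeriods.Zeta5Search.RVFlatGaugeBeyondM1Lemmas
import Summits.KontsevichZagierPeriods.Zeta5Search.CasoratianLawNoMultipole
import Summits.KontsevichZagierPeriods.Zeta5Search.XSaveConjectures
import Summits.KontsevichZagierPeriods.Zeta5Search.RVGaugePaths
import HarnessLib

/-!
# ζ(5) search — the FLAT `S₇`-gauge law, and the census's W-XS2, are THEOREMS at every prime beyond `m₁` (fam-rv gen-6)

HONEST FRAMING: systematic search; no irrationality claim unless certified.  Nothing in this file is an irrationality
statement; every theorem is an exact `p`-adic valuation statement about Brown–Zudilin's closed scalar `ρ(b)` and the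
dual-series Casoratian `Cas_j(b) = W(b+e_j)V(b) − W(b)V(b+e_j)` of the tree.

Cell `pub-zeta5`, family-designer seat `pub-zeta5-fam-rv-g6` (Rhin–Viola permutation-group refinements, gen 6, 2026-08-21).
Staged at `HOME/pub-zeta5-fam-rv/gen6/lean/RVFlatGaugeBeyondM1.lean`; proposed tree target
`Summits/KontsevichZagierPeriods/Zeta5Search/RVFlatGaugeBeyondM1.lean` (filing by a permitted lane; planner seats have no
Zeta5Search stage permission).  Part 2 of 2: part 1 = `RVFlatGaugeBeyondM1Lemmas.lean` (§1 bookkeeping `forms ≤ m₁`, §2 the gauge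
exponents beyond `m₁`, §3 `v_p(ρ(σ•b)) = −⌊d/p⌋` beyond `m₁`), to be filed first; this part imports it and otherwise ONLY accepted tree
files.  `lean check` rc 0, 0 `sorry` (part 1 standalone; parts 1+2 as one concatenation), axioms of the main theorems
`[propext, Classical.choice, Quot.sound]`.

## WHAT

gen-4 (`RVFlatGauge.lean`, p239743) typed the FLAT `S₇`-GAUGE LAW — Brown–Zudilin's (28)+(29)+(30) [BrZu22, §9] with the fifth
modulus `m₅` replaced by `m₅♭ = max(m₅, ⌊d/2⌋)` — as an INTERNALLY MINTED CONJECTURE `FlatGaugeLaw28` (0 violations in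
86,619 exact rows, tight in 2,676; it implies `GaugeLaw28`, `SymmetricGaugeLaw`, `PhiSaving` on the cone `d ≤ 2m₅`).  Nobody had
proved any slice of it as a gauge law.  THIS FILE PROVES IT ON THE FAR SIDE OF `m₁`: for every dual vector `b` with `b` and
`b + e_j` in the polytope (NO cone hypothesis), every prime `p ≥ 5` with `p > m₁(b)` (`m₁` = the largest of the 28 forms
`b_i`, `b₀ − b_i − b_k`), and every relabelling `σ ∈ S₇`:

* `flatGaugeLaw_of_m1_lt` : `−e_D♭(b,p) − v_p(ρ(σ•b)) ≤ v_p(Cas_j(b))` — (FLAT) = `FlatGaugeLaw`'s inequality;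
* `flatGaugeLaw28_of_m1_lt` : the identity-gauge case (FLAT-28);
* `symmetricGaugeLaw_of_m1_lt` : on the cone `d ≤ 2m₅`, Brown–Zudilin's own (28)+(29)+(30) inequality (`SymmetricGaugeLaw`);
* `gaugeBound_eq_cvBound_of_m1_lt` : beyond `m₁` the flat gauge bound and the typer's cluster-valuation bound (CV) are the SAME
  number `[p ≤ d(b)]`:  `−e_D♭ − v_p(ρ) = ⌊d/p⌋ − [2p ≤ d] = [p ≤ d] = min(1,⌊d/p⌋) − Σ⌊(b₀−b_i−b_k)/p⌋`;
* `casoratianLaw_of_m1_lt` : (CV) beyond `m₁` — `v_p(Cas_j(b)) ≥ [p ≤ d(b)]`;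
* (part 1) `padicValRat_rhoB_of_m1_lt`, `padicValRat_rhoB_perm_of_m1_lt` : `v_p(ρ(σ•b)) = −⌊d/p⌋` for EVERY `σ` — the permutation group
  gives NO saving beyond `m₁` (Brown–Zudilin's `ν_p = 0` there; their `Φₙ` is supported on `p ≤ m₁n`);
* `printedBound_eq_of_m1_lt` : the PRINTED (28) (modulus `m₅`) demands `⌊d/p⌋`, i.e. `v_p(Cas_j) ≥ 2` on `(m₁, d/2]` — one unit
  more than (FLAT)/(CV) demand and PROVE; this window is exactly where the census refuted (28) off the cone
  (`XSave.XS2_failsBeyondTwiceM1`, `XSave.witness28`: `v₅₃(P) = −1` at `b = (53; 6,5,4,3,2,1,0)`, `m₁ = 52 < 53 ≤ d/2 = 69` — of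
  which this file PROVES the half `v₅₃(P) ≥ −1`, §8);
* `padicValRat_P_of_m1_lt` and its two halves : for the `ζ(5)`-NUMERATOR `P = ρ·Cas_j`,  `v_p(P) ≥ −[2p ≤ d(b)]` — beyond `m₁`
  a prime divides `den P` AT MOST ONCE, and NOT AT ALL once `2p > d`;
* `m1_bOfA` : the a-side/b-side dictionary `m₁(b(a)) = m₁(a)` (`forms28 (b(a))` is a permutation of `(h₁(a),…,h₂₈(a))`,
  `forms28_bOfA_perm_hList`; index-by-index this is gen-3's `hForm_eq_pairForm`), and `POf_eq : XSave.POf a j = ρ(b(a))·Cas_j(b(a))` (rfl);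
* `xs2_window_polytope`, `xs2_upper_polytope` : THE CENSUS'S W-XS2 — `XSave.XS2_windowExponentLeOne` and
  `XSave.XS2_noPrimeBeyondHalfD` (typed `@[conjecture]`; 0 exceptions over the census union of 10,480 pairs `(a,n)` apart from
  the two symmetric corners `p ∈ {2,3}` the typed statements exclude: `p > m₁ ⟹ v_p(P) ≥ −1`, and `≥ 0` once `2p > d`) — PROVED ON
  THE POLYTOPE PART of their region for `p ≥ 5`, stated over the census's own `POf`, `m1Of`.

## MECHANISM (why `m₁` is the threshold on both sides)

Beyond `m₁` every one of the 28 forms is `< p`: on the GAUGE side `e_D = 0`, `e_D♭ = [2p ≤ d]` (`d ≤ 3m₅ ≤ 3m₁ < 3p ≤ p²`, gen-4's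
`dOf_le_three_mul_m5`), all fifteen `(b₀−b_j−b_k)!` and `b₁!,b₄!,…,b₇!` of `ρ` are `p`-adic units and `v_p(1/d!) = −⌊d/p⌋ ∈ {0,−1,−2}`
in every labelling; on the CASORATIAN side `Σ⌊(b₀−b_i−b_k)/p⌋ = 0`, the refund is `[p ≤ d]`, and — the one real input —
every block `[b_k, b₀−b_k]` except the least parameter's is SHORT (`b₀ − 2b_k ≤ b₀ − b_k − b_min ≤ m₁ < p`), so no residue class
carries two poles and typer g9's `ClusterValuation.casoratianLaw_of_noMultipole` (single-row law + THEOREM V + moment identities,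
`CasoratianLawNoMultipole.lean`) yields (CV); its window `p² > b₀ + 2` is automatic (`b₀ ≤ 3m₁`).  The (CV) half is therefore typer
g9's record-ray argument `recordRayCV_upper` (`p > 17n`) run for an ARBITRARY dual vector, with the short-block threshold identified
as `m₁(b)`; the gauge half, the coincidence of the two bounds, the `S₇`-triviality and the dictionary are this file's.

## VALUE, HONESTLY (numbers, not adjectives)

* DENOMINATOR SAVING PROVED (T4/T3-support): the flat gauge law is now a THEOREM on `{p prime : p ≥ 5, p > m₁(b)}` for every
  polytope point — in particular on the whole window `(m₁n, dn/2]` of ALL 244 sampled off-cone directions where printed (28) is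
  FALSE (census g6/g7): there the true multiplicity ONE is now proved, not observed.  On the cone (`d ≤ 2m₅`, 874/875 sampled
  directions incl. Brown–Zudilin's record) the window `(m₁n, dn/2]` is empty and the statement reduces to (CV) on `(m₁n, dn]` plus
  integrality beyond — for the record ray (`m₁ = 18n`, `d = 25n`) this lies inside the range `p > 17n` of the tree's
  `recordRayCV_upper` (typer g9), so nothing there is new.
* γ LEDGER: 0.  The record's proved exponent (census g20: λ_proved 51.354 nats/step, γ 0.85488 < 0.86597) already contains (CV)
  beyond `17n` (rung of typer g9); this file adds no nats on the record or on any NEAR-MISSES ray.  It serves T4 (a typed-and-proved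
  structural theorem about the BZ/RV gauge) and T3 only as a certified denominator statement for off-cone families (whose γ is far
  below the record anyway, census §11).
* Q-RV5(1) of FAMILY §15.9 ("is the flat modulus DERIVABLE from an `S₇`-invariant divisor calculus rather than observed?"):
  answered YES on `(m₁, ∞)` — there the flat modulus is forced by Legendre on `1/d!` against ONE factor `p` of the Casoratian.
  Below `m₁` (where all of Brown–Zudilin's actual saving `Φₙ⁻¹ D` lives) the question stays OPEN: (CV) below `m₁` rests on the
  OBSERVED multi-block laws (`CVBlockReduction`), and FLAT-vs-(CV) are not even comparable there (gen-4 §14.5: 1,786 rows with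
  FLAT > CV-bound, 31,447 with CV > FLAT).

## NOT PROVED HERE (do not over-read)

(a) any prime `p ≤ m₁(b)` — the entire region of the `S₇` saving; (b) `p = 3` (the cluster theorems need `p ≥ 5`; `p = 2` is excluded
by the census's own corner `cornerTwo`); (c) the sliver `InRegion ∖ InPolytope` of the census's XS2 (parity slack `2b_i = b₀ + 1`);
(d) `FlatGaugeLaw28` / `GaugeLaw28` / `SymmetricGaugeLaw` / `CasoratianValuationLaw` as wholes — they remain conjecture nodes;
(e) anything about irrationality or γ.

References: [BrZu22] F. Brown, W. Zudilin, arXiv:2210.03391v2, §9 (28)–(30), §11–12; [Zu04] W. Zudilin, J. Théor. Nombres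
Bordeaux 16 (2004), Lemma 4.4–4.5; [RV01] G. Rhin, C. Viola, Acta Arith. 97 (2001) (the `ζ(3)` permutation group this programme
lifts).  Tree inputs: `RVFlatGauge`, `RVFlatGaugeStructure` (fam-rv gen-4), `CasoratianLawNoMultipole` (typer g9),
`PermutationSavingForms28` (census g16), `RVGaugePaths` (fam-rv gen-3), `XSaveConjectures`/`XSaveRhoValuation` (census g6).
-/

namespace Summit.KontsevichZagierPeriods.Zeta5Search.RVFlatGauge

open Finset
open Summit.KontsevichZagierPeriods.Zeta5Search.CasoratianValuation (casoratian shift InPolytope pairFloors refund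
  CasoratianValuationLaw)
open Summit.KontsevichZagierPeriods.Zeta5Search.WedgeDictionary (dOf Epairs)
open Summit.KontsevichZagierPeriods.Zeta5Search.SymmetricGauge

/-! ### §4 THE THEOREMS: beyond `m₁` the flat gauge bound IS the (CV) bound, and both HOLD -/

/-- Beyond `m₁` the window hypothesis `p² > b₀ + 2` of the cluster-valuation theorems is automatic (`b₀ ≤ 3m₁ < 3p`, `p ≥ 5`). -/
theorem window_of_m1_lt {b : ℕ → ℤ} {p : ℕ} (hp5 : 5 ≤ p) (hm : m1 b < p) : (b 0 + 2 : ℤ) < (p : ℤ) ^ 2 := by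
  have h3 := b0_le_three_mul_m1 b
  have hsq : (p : ℤ) ^ 2 = (p : ℤ) * p := sq _
  have h5 : (5 : ℤ) * p ≤ (p : ℤ) * p := by
    have : (5 : ℤ) ≤ p := by exact_mod_cast hp5
    nlinarith
  omega

/-- **(CV) beyond `m₁` is a THEOREM** — for `b`, `b + e_j` in the polytope and every prime `p > m₁(b)`, `p ≥ 5`:
`v_p(Cas_j(b)) ≥ min(1,⌊d/p⌋) − Σ⌊(b₀−b_i−b_k)/p⌋ = [p ≤ d(b)]`.  Proof: beyond `m₁` every block `[b_k, b₀ − b_k]` other than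
the least parameter's is shorter than `p` (`b₀ − 2b_k ≤ b₀ − b_k − b_min ≤ m₁ < p`), so no residue class carries two poles and
typer g9's `casoratianLaw_of_noMultipole` (single-row law + THEOREM V + moments) applies; the window `p² > b₀ + 2` is automatic. -/
theorem casoratianLaw_of_m1_lt (b : ℕ → ℤ) {j p : ℕ} (hb : InPolytope b) (hj1 : 1 ≤ j) (hj7 : j ≤ 7)
    (hb' : InPolytope (shift b j)) (hp : p.Prime) (hp5 : 5 ≤ p) (hm : m1 b < p) (hne : casoratian b j ≠ 0) :
    refund b p - pairFloors b p ≤ padicValRat p (casoratian b j) := by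
  haveI : Fact p.Prime := ⟨hp⟩
  obtain ⟨i, hi, hmin⟩ := exists_min_image (range 7) (fun k => b (k + 1)) ⟨0, by simp⟩
  refine ClusterValuation.casoratianLaw_of_noMultipole b hb hj1 hj7 hb' hp5 (window_of_m1_lt hp5 hm)
    (fun x _ => ClusterValuation.classPoleCount_le_one_of_short_blocks b hb hp.pos (i := i) ?_ x) hne
  intro k hk
  obtain ⟨hki, hk7⟩ := mem_erase.1 hk
  have hk7' := mem_range.1 hk7
  have hi7 := mem_range.1 hi
  have h1 := pair_le_m1 b hk7' hi7 hki
  have h2 : b (i + 1) ≤ b (k + 1) := hmin k hk7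
  omega

/-- **The coincidence beyond `m₁`:** for `b` in the polytope and a prime `p > m₁(b)`, `p ≥ 5`, the flat `S₇`-gauge bound and
the (CV) bound are the SAME number, the indicator of `p ≤ d(b)`:
`−e_D♭(b,p) − v_p(ρ(b)) = ⌊d/p⌋ − [2p ≤ d] = [p ≤ d] = min(1,⌊d/p⌋) − Σ⌊(b₀−b_i−b_k)/p⌋`. -/
theorem gaugeBound_eq_cvBound_of_m1_lt {b : ℕ → ℤ} (hb : InPolytope b) {p : ℕ} (hp : p.Prime) (hp5 : 5 ≤ p)
    (hm : m1 b < p) : -eDflat b p - padicValRat p (rhoB b) = refund b p - pairFloors b p := by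
  have hd0 := dOf_nonneg hb
  have hd3 := dOf_le_three_mul_m1 hb
  have hp0 : (0 : ℤ) < p := by exact_mod_cast hp.pos
  rw [eDflat_eq_of_m1_lt hb (by omega) hm, padicValRat_rhoB_of_m1_lt hb hp (by rintro rfl; omega) hm,
    refund_eq_of_pos hb hp.pos, pairFloors_eq_zero_of_m1_lt hb hm]
  have g1 : 1 ≤ dOf b / p ↔ (p : ℤ) ≤ dOf b := by rw [Int.le_ediv_iff_mul_le hp0, one_mul]
  have g2 : 2 ≤ dOf b / p ↔ 2 * (p : ℤ) ≤ dOf b := by rw [Int.le_ediv_iff_mul_le hp0]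
  have g3 : dOf b / p < 3 := by rw [Int.ediv_lt_iff_lt_mul hp0]; omega
  have g0 : 0 ≤ dOf b / p := Int.ediv_nonneg hd0 hp0.le
  split_ifs <;> omega

/-- Same statement read for Brown–Zudilin's PRINTED (28) (no flat correction): beyond `m₁` its bound is `⌊d/p⌋`, i.e. (28) as
printed demands `v_p(Cas_j(b)) ≥ 2` at every prime `m₁ < p ≤ d/2` — one unit MORE than the flat law / (CV) (which demand `1`, and
`1` is PROVED below); the census's off-cone witnesses (`XSave.witness28`: `v₅₃(P) = −1` at `a = (42,5,44,4,46,50,52,47)`, where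
`m₁ = 52 < 53 ≤ d/2 = 69`) show the truth there is `1`.  This is the arithmetic of the "double count": `ρ`'s `1/d!` charges
`⌊d/p⌋ = 2` at `2p ≤ d < 3p`, the Casoratian inherits exactly one factor `p` from (W∞). -/
theorem printedBound_eq_of_m1_lt {b : ℕ → ℤ} (hb : InPolytope b) {p : ℕ} (hp : p.Prime) (hp5 : 5 ≤ p) (hm : m1 b < p) :
    -eD b p - padicValRat p (rhoB b) = dOf b / p := by
  rw [eD_eq_zero_of_m1_lt b hm, padicValRat_rhoB_of_m1_lt hb hp (by rintro rfl; omega) hm]; ring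

/-- **(FLAT-28) beyond `m₁` is a THEOREM:** for `b`, `b + e_j` in the polytope (NO cone hypothesis) and every prime `p > m₁(b)`,
`p ≥ 5`: `v_p(Cas_j(b)) ≥ −e_D♭(b,p) − v_p(ρ(b))`, i.e. `d_{m₁}⋯d_{m₄}·d_{max(m₅,⌊d/2⌋)} · ρ(b)·Cas_j(b) ∈ ℤ_(p)`. -/
theorem flatGaugeLaw28_of_m1_lt (b : ℕ → ℤ) {j p : ℕ} (hb : InPolytope b) (hj1 : 1 ≤ j) (hj7 : j ≤ 7)
    (hb' : InPolytope (shift b j)) (hp : p.Prime) (hp5 : 5 ≤ p) (hm : m1 b < p) (hne : casoratian b j ≠ 0) :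
    -eDflat b p - padicValRat p (rhoB b) ≤ padicValRat p (casoratian b j) := by
  rw [gaugeBound_eq_cvBound_of_m1_lt hb hp hp5 hm]
  exact casoratianLaw_of_m1_lt b hb hj1 hj7 hb' hp hp5 hm hne

/-- **(FLAT) beyond `m₁` is a THEOREM in EVERY gauge `σ ∈ S₇`** (= `FlatGaugeLaw` ∧ `SymmetricGaugeLaw` at the primes `p > m₁(b)`;
on the cone `d ≤ 2m₅` this is (BZ-GAUGE) = (28)+(29)+(30) itself there). -/
theorem flatGaugeLaw_of_m1_lt (b : ℕ → ℤ) {j p : ℕ} (σ : Equiv.Perm (Fin 7)) (hb : InPolytope b) (hj1 : 1 ≤ j)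
    (hj7 : j ≤ 7) (hb' : InPolytope (shift b j)) (hp : p.Prime) (hp5 : 5 ≤ p) (hm : m1 b < p)
    (hne : casoratian b j ≠ 0) :
    -eDflat b p - padicValRat p (rhoB (permLower σ b)) ≤ padicValRat p (casoratian b j) := by
  rw [padicValRat_rhoB_perm_of_m1_lt hb σ hp (by rintro rfl; omega) hm]
  exact flatGaugeLaw28_of_m1_lt b hb hj1 hj7 hb' hp hp5 hm hne

/-- … and in Brown–Zudilin's printed shape on the cone: `SymmetricGaugeLaw`'s inequality at every `p > m₁(b)`. -/
theorem symmetricGaugeLaw_of_m1_lt (b : ℕ → ℤ) {j p : ℕ} (σ : Equiv.Perm (Fin 7)) (hb : InPolytope b) (hj1 : 1 ≤ j)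
    (hj7 : j ≤ 7) (hb' : InPolytope (shift b j)) (hd : dOf b ≤ 2 * m5 b) (hp : p.Prime) (hp5 : 5 ≤ p) (hm : m1 b < p)
    (hne : casoratian b j ≠ 0) :
    -eD b p - padicValRat p (rhoB (permLower σ b)) ≤ padicValRat p (casoratian b j) := by
  have key := flatGaugeLaw_of_m1_lt b σ hb hj1 hj7 hb' hp hp5 hm hne
  rwa [eDflat_eq_eD_of_cone p hd] at key

/-! ### §5 The denominators of `P = ρ·Cas` beyond `m₁`: support `(m₁, d/2]`, multiplicity `≤ 1` (the census's W-XS2, b-side) -/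

/-- **`v_p(ρ(b)·Cas_j(b)) ≥ −[2p ≤ d(b)]` for every prime `p > m₁(b)`, `p ≥ 5`** (`b`, `b + e_j` in the polytope): beyond `m₁` the
`ζ(5)`-numerator `P = ρ·(W′V − WV′)` has `p` in its denominator AT MOST ONCE, and NOT AT ALL once `2p > d(b)`. -/
theorem padicValRat_P_of_m1_lt (b : ℕ → ℤ) {j p : ℕ} (hb : InPolytope b) (hj1 : 1 ≤ j) (hj7 : j ≤ 7)
    (hb' : InPolytope (shift b j)) (hp : p.Prime) (hp5 : 5 ≤ p) (hm : m1 b < p) :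
    -(if 2 * (p : ℤ) ≤ dOf b then (1 : ℤ) else 0) ≤ padicValRat p (rhoB b * casoratian b j) := by
  haveI : Fact p.Prime := ⟨hp⟩
  by_cases hne : casoratian b j = 0
  · rw [hne, mul_zero, padicValRat.zero]; split_ifs <;> norm_num
  have key := flatGaugeLaw28_of_m1_lt b hb hj1 hj7 hb' hp hp5 hm hne
  rw [eDflat_eq_of_m1_lt hb (by omega) hm] at key
  rw [padicValRat.mul (rhoB_ne_zero b) hne]
  linarith

/-- W-XS2, window half, b-side: `v_p(P) ≥ −1` beyond `m₁`. -/
theorem neg_one_le_padicValRat_P_of_m1_lt (b : ℕ → ℤ) {j p : ℕ} (hb : InPolytope b) (hj1 : 1 ≤ j) (hj7 : j ≤ 7)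
    (hb' : InPolytope (shift b j)) (hp : p.Prime) (hp5 : 5 ≤ p) (hm : m1 b < p) :
    -1 ≤ padicValRat p (rhoB b * casoratian b j) := by
  have := padicValRat_P_of_m1_lt b hb hj1 hj7 hb' hp hp5 hm
  split_ifs at this <;> linarith

/-- W-XS2, upper half, b-side: NO prime beyond `max(m₁, d/2)` divides the denominator of `P`. -/
theorem padicValRat_P_nonneg_of_halfD_lt (b : ℕ → ℤ) {j p : ℕ} (hb : InPolytope b) (hj1 : 1 ≤ j) (hj7 : j ≤ 7)
    (hb' : InPolytope (shift b j)) (hp : p.Prime) (hp5 : 5 ≤ p) (hm : m1 b < p) (hd : dOf b < 2 * (p : ℤ)) :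
    0 ≤ padicValRat p (rhoB b * casoratian b j) := by
  have := padicValRat_P_of_m1_lt b hb hj1 hj7 hb' hp hp5 hm
  rw [if_neg (by omega)] at this
  simpa using this


/-! ### §6 The a-side dictionary: `forms28 (b(a))` is a permutation of Brown–Zudilin's `(h₁(a),…,h₂₈(a))`, so `m₁(b(a)) = m₁(a)` -/

section ASide
open Literature.NumberTheory.Irrationality.BrownZudilin2022 (hList hForm bOfA)
open Summit.KontsevichZagierPeriods.Zeta5Search.RVGauge (pairTable pairForm hForm_eq_pairForm pairTable_perm)
open Summit.KontsevichZagierPeriods.Zeta5Search.WedgeDictionary (allPairs)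

/-- `1,…,28`. -/
def idx28 : List ℕ := [1, 2, 3, 4, 5, 6, 7, 8, 9, 10, 11, 12, 13, 14, 15, 16, 17, 18, 19, 20, 21, 22, 23, 24, 25, 26, 27, 28]

/-- `hList a` is `hForm a` mapped over `1,…,28`. -/
theorem hList_eq_map (a : Fin 8 → ℤ) : hList a = idx28.map (hForm a) := by
  simp [idx28, hForm, hList]

/-- Reading gen-3's `pairTable` entry by entry over `1,…,28` returns the table. -/
theorem idx28_map_pairTable : idx28.map (fun i => pairTable.getD (i - 1) (0, 0)) = pairTable := by decide

/-- `forms28 b` is `pairForm b` mapped over the seven singleton pairs followed by the 21 pairs `allPairs` (both sides unfold to gen-4's explicit list `forms28_eq`). -/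
theorem forms28_eq_map_pairForm (b : ℕ → ℤ) :
    forms28 b = (((List.range 7).map fun v => (0, v + 1)) ++ allPairs).map (pairForm b) := by
  rw [forms28_eq]
  simp [allPairs, pairForm, List.range, List.range.loop]

/-- **Dictionary as a permutation of lists:** the 28 forms of `b(a)` (slots, then pairs in `forms28` order) are a permutation of
`h₁(a),…,h₂₈(a)` (gen-3's `hForm_eq_pairForm` index by index + `pairTable_perm`). -/
theorem forms28_bOfA_perm_hList (a : Fin 8 → ℤ) : (forms28 (bOfA a)).Perm (hList a) := by
  have h1 : hList a = pairTable.map (pairForm (bOfA a)) := by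
    rw [hList_eq_map, ← idx28_map_pairTable, List.map_map]
    refine List.map_congr_left fun i hi => ?_
    have hi' : 1 ≤ i ∧ i ≤ 28 := by simp only [idx28, List.mem_cons, List.not_mem_nil, or_false] at hi; omega
    simpa using hForm_eq_pairForm a i hi'.1 hi'.2
  rw [h1, forms28_eq_map_pairForm]
  exact (pairTable_perm.map (pairForm (bOfA a))).symm

/-- **`m₁(b(a)) = m₁(a)`**: the census's `XSave.m1Of` (largest `h_i(a)`) is gen-1's `m1 ∘ bOfA` (largest of the 28 dual forms). -/
theorem m1_bOfA (a : Fin 8 → ℤ) : m1 (bOfA a) = XSave.m1Of a := by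
  unfold m1 XSave.m1Of
  exact (forms28_bOfA_perm_hList a).foldr_eq 0

/-- The census's `ζ(5)`-numerator IS `ρ(b(a))·Cas_j(b(a))` (definitional). -/
theorem POf_eq (a : Fin 8 → ℤ) (j : ℕ) : XSave.POf a j = rhoB (bOfA a) * casoratian (bOfA a) j := rfl

/-! ### §7 W-XS2 on the polytope is a THEOREM (a-side, the census's own objects `POf`, `m1Of`) -/

/-- **W-XS2, window half, POLYTOPE PART — PROVED.**  For any direction vector `c` (e.g. `c = n • a`) whose dual vector `b(c)` and
`b(c) + e_j` lie in the polytope, and every prime `p ≥ 5` with `p > m₁(c)`: `v_p(P(c)) ≥ −1`.  (The census's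
`XSave.XS2_windowExponentLeOne` quantifies over the slightly larger `InRegion` — parity slack `2b_i ≤ b₀ + 1` — and allows `p = 3`;
those two slivers are NOT covered here.) -/
theorem xs2_window_polytope (c : Fin 8 → ℤ) {j p : ℕ} (hb : InPolytope (bOfA c)) (hj1 : 1 ≤ j) (hj7 : j ≤ 7)
    (hb' : InPolytope (shift (bOfA c) j)) (hp : p.Prime) (hp5 : 5 ≤ p) (hm : XSave.m1Of c < p) :
    -1 ≤ padicValRat p (XSave.POf c j) := by
  rw [POf_eq]
  exact neg_one_le_padicValRat_P_of_m1_lt _ hb hj1 hj7 hb' hp hp5 (by rw [m1_bOfA]; exact hm)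

/-- **W-XS2, upper half, POLYTOPE PART — PROVED.**  Same hypotheses and `2p > d(b(c))`: `v_p(P(c)) ≥ 0` — no prime beyond
`max(m₁, d/2)` divides the denominator of the `ζ(5)`-numerator.  (Census `XSave.XS2_noPrimeBeyondHalfD`, restricted from
`InRegion` to the polytope.) -/
theorem xs2_upper_polytope (c : Fin 8 → ℤ) {j p : ℕ} (hb : InPolytope (bOfA c)) (hj1 : 1 ≤ j) (hj7 : j ≤ 7)
    (hb' : InPolytope (shift (bOfA c) j)) (hp : p.Prime) (hp5 : 5 ≤ p) (hm : XSave.m1Of c < p)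
    (hd : dOf (bOfA c) < 2 * (p : ℤ)) : 0 ≤ padicValRat p (XSave.POf c j) := by
  rw [POf_eq]
  exact padicValRat_P_nonneg_of_halfD_lt _ hb hj1 hj7 hb' hp hp5 (by rw [m1_bOfA]; exact hm) hd

end ASide

/-! ### §8 Kernel instances -/

/-- The polytope predicate is decidable on concrete vectors (two bounded quantifiers and a finite sum). -/
instance decInPolytope (b : ℕ → ℤ) : Decidable (InPolytope b) := by
  unfold InPolytope Summit.KontsevichZagierPeriods.Zeta5Search.DualSeries.InBox; infer_instance

/-- The off-cone witness direction of the census (`XSave.witness28`, `a = (42,5,44,4,46,50,52,47)`, `b(a) = bXS = (53; 6,5,4,3,2,1,0)`,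
`m₁ = 52`, `d = 138`): at `p = 53, 59, 61, 67 ∈ (m₁, d/2]` the PROVED bound is `v_p(Cas₇) ≥ [p ≤ d] = 1`, i.e. `v_p(P) ≥ −1`
(the census measured `v₅₃(P) = −1`: tight), and at `p = 71 > d/2` it gives `v₇₁(P) ≥ 0`. -/
example : m1 bXS = 52 ∧ dOf bXS = 138 ∧ refund bXS 53 - pairFloors bXS 53 = 1 ∧ -eDflat bXS 53 = -1 ∧
    refund bXS 71 - pairFloors bXS 71 = 1 ∧ eDflat bXS 71 = 0 := by decide

example : InPolytope bXS ∧ InPolytope (shift bXS 7) := by decide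

/-- Hence, UNCONDITIONALLY: `v₇₁(ρ(bXS)·Cas₇(bXS)) ≥ 0` and `v₅₃(ρ(bXS)·Cas₇(bXS)) ≥ −1` (instances of §5). -/
example : 0 ≤ padicValRat 71 (rhoB bXS * casoratian bXS 7) :=
  padicValRat_P_nonneg_of_halfD_lt bXS (j := 7) (p := 71) (by decide) (by norm_num) (by norm_num) (by decide) (by norm_num)
    (by norm_num) (by rw [show m1 bXS = 52 by decide]; norm_num) (by rw [show dOf bXS = 138 by decide]; norm_num)

example : -1 ≤ padicValRat 53 (rhoB bXS * casoratian bXS 7) :=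
  neg_one_le_padicValRat_P_of_m1_lt bXS (j := 7) (p := 53) (by decide) (by norm_num) (by norm_num) (by decide) (by norm_num)
    (by norm_num) (by rw [show m1 bXS = 52 by decide]; norm_num)

/-- Brown–Zudilin's record `b = (41; 17,16,15,14,13,12,11)` (`m₁ = 18`, `d = 25`): beyond `m₁` the only primes `≤ d` are `19, 23`,
where the PROVED bound is `v_p(Cas_j) ≥ 1` and (since `2p > 25`) `v_p(P) ≥ 0`: no prime `> 18` in the denominator of `P` at the
record point — the `n = 1` instance of the census's D-law for the record family. -/
example : m1 bRecord = 18 ∧ dOf bRecord = 25 ∧ refund bRecord 19 - pairFloors bRecord 19 = 1 ∧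
    refund bRecord 23 - pairFloors bRecord 23 = 1 ∧ eDflat bRecord 19 = 0 ∧ eDflat bRecord 29 = 0 := by decide

example : 0 ≤ padicValRat 19 (rhoB bRecord * casoratian bRecord 1) :=
  padicValRat_P_nonneg_of_halfD_lt bRecord (j := 1) (p := 19) (by decide) (by norm_num) (by norm_num) (by decide)
    (by norm_num) (by norm_num) (by rw [show m1 bRecord = 18 by decide]; norm_num)
    (by rw [show dOf bRecord = 25 by decide]; norm_num)

end Summit.KontsevichZagierPeriods.Zeta5Search.RVFlatGauge
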